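import Summits.AtomisticToContinuum.Crystallization.Theorems.PricedLinkCensusChargedPeriodicIsOptimalPacking
import Literature.MathematicalPhysics.StatisticalMechanics.LocalMatchingCompactness

/-!
# `LocalLimitStable` (stmt-AtomisticToContinuum-14086), helpers I: Lennard-Jones fields of
# separated configurations along two-way matched sequences

Support file for the item `GscTwinLoopSurgery.LocalLimitStable` (every local limit of translated
Lennard-Jones ground states is a hard-core canonical ground state configuration).  The analytic
input of the transplant argument is the **continuity of the field energy**
`w ↦ Σ_{q ∈ S} V_LJ(|w − q|)` of a `δ`-separated configuration `S ⊆ ℝ³` under local two-way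
matching (`tendsto_sum_lennardJones_of_matched`): if finite `δ`-separated sets `S_j` are, for
every radius `R` and tolerance `ε > 0`, eventually two-way `ε`-matched with the `δ`-separated set
`X'` on the ball `B_R(w₀)`, and `w_j → w₀` with `w₀` at positive distance from `X'`, then
`Σ_{q ∈ S_j} V_LJ(|w_j − q|) → Σ'_{q ∈ X'} V_LJ(|w₀ − q|)`.  Three elementary inputs:

* `sum_inv_pow_six_le_of_far`, `sum_abs_lennardJones_le_of_far` — UNIFORM far tails: the points
  of a `δ`-separated finite set at distance `≥ T ≥ max(δ, 1)` from `w` contribute at most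
  `(1/4) · 250 δ⁻⁵ / T` in absolute value (the far sixth-power sum
  `ChargedPeriodicOptimal.sum_inv_pow_six_far_le` of the tree, seen from an external point);
* `exists_pos_le_dist_of_not_mem` — a point off a separated set is at positive distance from it
  (separated subsets of balls are finite, `finite_of_forall_le_dist_of_subset_closedBall`);
* `exists_modulus_lennardJones` — a modulus of continuity of `V_LJ` on `[a, b]`, `a > 0`
  (Heine–Cantor).

All `[folklore]` (Blanc–Lewin 2015, §2.2: fields of uniformly separated configurations are
absolutely summable with `r⁻⁶` tails; Sütő 2011, §7: stability passes to local limits).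
-/

noncomputable section

open scoped BigOperators Topology
open Filter Set Metric

namespace Summit.AtomisticToContinuum.Crystallization.Theorems.LocalLimitStable

open Literature.MathematicalPhysics.StatisticalMechanics
open Summit.AtomisticToContinuum.Crystallization.Theorems.ChargedPeriodicOptimal
  (sum_inv_pow_six_far_le)

open Summit.AtomisticToContinuum.Crystallization.Theorems.ChargedEnergyGapNegative (E3)

/-! ## Uniform far tails -/

/-- **Far sixth-power sum from an external point.** If the points of the finite set `S ⊆ ℝ³`
are pairwise `≥ δ` apart and all at distance `≥ T ≥ δ` from `w`, then
`Σ_{q ∈ S} |w − q|⁻⁶ ≤ 250 δ⁻⁵ T⁻¹` (the tree's `sum_inv_pow_six_far_le` for the configuration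
`(w, S)`, which is `δ`-separated). [folklore] -/
theorem sum_inv_pow_six_le_of_far (S : Finset E3) (w : E3) {δ T : ℝ} (hδ : 0 < δ)
    (hδT : δ ≤ T) (hS : ∀ p ∈ S, ∀ q ∈ S, p ≠ q → δ ≤ dist p q)
    (hfar : ∀ q ∈ S, T ≤ dist w q) :
    ∑ q ∈ S, (dist w q)⁻¹ ^ 6 ≤ 250 * δ⁻¹ ^ 5 * T⁻¹ := by
  classical
  have hT : 0 < T := hδ.trans_le hδT
  set e := S.equivFin with he
  set x : Fin (S.card + 1) → E3 := Fin.cons w (fun j => ((e.symm j : S) : E3)) with hx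
  have hx0 : x 0 = w := by simp [hx]
  have hxs : ∀ j : Fin S.card, x j.succ = ((e.symm j : S) : E3) := fun j => by simp [hx]
  have hsep : ∀ k l, k ≠ l → δ ≤ dist (x k) (x l) := by
    intro k l hkl
    rcases Fin.eq_zero_or_eq_succ k with rfl | ⟨j, rfl⟩ <;>
      rcases Fin.eq_zero_or_eq_succ l with rfl | ⟨j', rfl⟩
    · exact absurd rfl hkl
    · rw [hx0, hxs]
      exact hδT.trans (hfar _ (e.symm j').2)
    · rw [hx0, hxs, dist_comm]
      exact hδT.trans (hfar _ (e.symm j).2)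
    · rw [hxs, hxs]
      exact hS _ (e.symm j).2 _ (e.symm j').2 fun h =>
        hkl (by rw [e.symm.injective (Subtype.ext h)])
  have key := sum_inv_pow_six_far_le x hδ hsep 0 hT
  have hfilter : (Finset.univ.erase (0 : Fin (S.card + 1))).filter
      (fun k => T ≤ dist (x 0) (x k)) = Finset.univ.erase 0 := by
    refine Finset.filter_true_of_mem fun k hk => ?_
    rcases Fin.eq_zero_or_eq_succ k with rfl | ⟨j, rfl⟩
    · exact absurd rfl (Finset.ne_of_mem_erase hk)
    · rw [hx0, hxs]
      exact hfar _ (e.symm j).2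
  rw [hfilter] at key
  have h00 : (dist (x 0) (x 0))⁻¹ ^ 6 = 0 := by simp
  rw [Finset.sum_erase Finset.univ (f := fun k => (dist (x 0) (x k))⁻¹ ^ 6) h00,
    Fin.sum_univ_succ, h00, zero_add] at key
  simp only [hx0, hxs] at key
  rwa [Equiv.sum_comp e.symm (fun z : S => (dist w (z : E3))⁻¹ ^ 6),
    Finset.sum_coe_sort S (fun q => (dist w q)⁻¹ ^ 6)] at key

/-- **Uniform far Lennard-Jones tails.** If the points of the finite set `S ⊆ ℝ³` are pairwise
`≥ δ` apart and all at distance `≥ T` from `w`, with `T ≥ δ` and `T ≥ 1`, then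
`Σ_{q ∈ S} |V_LJ(|w − q|)| ≤ (1/4) · 250 δ⁻⁵ T⁻¹` (`|V_LJ(t)| ≤ t⁻⁶/4` for `t ≥ 1`). The bound
does not depend on `S`: this is the uniform tail estimate of the transplant argument. [folklore] -/
theorem sum_abs_lennardJones_le_of_far (S : Finset E3) (w : E3) {δ T : ℝ} (hδ : 0 < δ)
    (hδT : δ ≤ T) (h1T : 1 ≤ T) (hS : ∀ p ∈ S, ∀ q ∈ S, p ≠ q → δ ≤ dist p q)
    (hfar : ∀ q ∈ S, T ≤ dist w q) :
    ∑ q ∈ S, |lennardJones (dist w q)| ≤ 1 / 4 * (250 * δ⁻¹ ^ 5 * T⁻¹) := by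
  have h14 : ((1 : ℝ)⁻¹ ^ 6 / 12 + 1 / 6) = 1 / 4 := by norm_num
  have hterm : ∀ q ∈ S, |lennardJones (dist w q)| ≤ 1 / 4 * (dist w q)⁻¹ ^ 6 := fun q hq => by
    have := abs_lennardJones_le_of_le one_pos (h1T.trans (hfar q hq))
    rwa [h14] at this
  calc ∑ q ∈ S, |lennardJones (dist w q)| ≤ ∑ q ∈ S, 1 / 4 * (dist w q)⁻¹ ^ 6 :=
        Finset.sum_le_sum hterm
    _ = 1 / 4 * ∑ q ∈ S, (dist w q)⁻¹ ^ 6 := by rw [Finset.mul_sum]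
    _ ≤ 1 / 4 * (250 * δ⁻¹ ^ 5 * T⁻¹) :=
        mul_le_mul_of_nonneg_left (sum_inv_pow_six_le_of_far S w hδ hδT hS hfar) (by norm_num)

/-! ## Hard-core radius of a point off a separated set -/

/-- A point `w₀` off a `δ`-separated set `X' ⊆ ℝ³` is at positive distance from it: only finitely
many points of `X'` lie within `1` of `w₀` (`finite_of_forall_le_dist_of_subset_closedBall`),
each at positive distance. [folklore] -/
theorem exists_pos_le_dist_of_not_mem {X' : Set E3} {δ : ℝ} (hδ : 0 < δ)
    (hX' : ∀ p ∈ X', ∀ q ∈ X', p ≠ q → δ ≤ dist p q) {w₀ : E3} (hw₀ : w₀ ∉ X') :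
    ∃ ρ₀ : ℝ, 0 < ρ₀ ∧ ∀ q ∈ X', ρ₀ ≤ dist w₀ q := by
  have hfin : (X' ∩ closedBall w₀ 1).Finite :=
    finite_of_forall_le_dist_of_subset_closedBall hδ
      (fun p hp q hq hpq => hX' p hp.1 q hq.1 hpq) Set.inter_subset_right
  by_cases hne : (X' ∩ closedBall w₀ 1).Nonempty
  · obtain ⟨q₀, hq₀, hmin⟩ := hfin.toFinset.exists_min_image (fun q => dist w₀ q)
      ((Set.Finite.toFinset_nonempty hfin).2 hne)
    rw [Set.Finite.mem_toFinset] at hq₀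
    have hq₀pos : 0 < dist w₀ q₀ := dist_pos.2 fun h => hw₀ (h ▸ hq₀.1)
    refine ⟨min 1 (dist w₀ q₀), lt_min one_pos hq₀pos, fun q hq => ?_⟩
    by_cases hq1 : dist w₀ q ≤ 1
    · have := hmin q (by
        rw [Set.Finite.mem_toFinset]
        exact ⟨hq, by rwa [mem_closedBall, dist_comm]⟩)
      exact (min_le_right _ _).trans this
    · exact (min_le_left _ _).trans (not_le.1 hq1).le
  · refine ⟨1, one_pos, fun q hq => ?_⟩
    by_contra h
    exact hne ⟨q, hq, by rw [mem_closedBall, dist_comm]; exact (not_le.1 h).le⟩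

/-! ## A modulus of continuity of `V_LJ` away from the origin -/

/-- **Modulus of continuity.** On `[a, b]` with `a > 0` the Lennard-Jones potential is uniformly
continuous (Heine–Cantor): for every `κ > 0` there is `η > 0` with `|V_LJ(s) − V_LJ(t)| < κ`
whenever `s, t ∈ [a, b]`, `|s − t| < η`. [folklore] -/
theorem exists_modulus_lennardJones {a b κ : ℝ} (ha : 0 < a) (hκ : 0 < κ) :
    ∃ η : ℝ, 0 < η ∧ ∀ s t : ℝ, a ≤ s → s ≤ b → a ≤ t → t ≤ b → |s - t| < η →
      |lennardJones s - lennardJones t| < κ := by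
  have hcont : ContinuousOn lennardJones (Icc a b) :=
    continuousOn_lennardJones.mono fun s hs => by
      simp only [mem_compl_iff, mem_singleton_iff]
      exact (ha.trans_le hs.1).ne'
  obtain ⟨η, hη, h⟩ := Metric.uniformContinuousOn_iff.1
    (isCompact_Icc.uniformContinuousOn_of_continuous hcont) κ hκ
  refine ⟨η, hη, fun s t has hsb hat htb hst => ?_⟩
  have := h s ⟨has, hsb⟩ t ⟨hat, htb⟩ (by rwa [Real.dist_eq])
  rwa [Real.dist_eq] at this

/-! ## Continuity of the field energy under local two-way matching -/

/-- **Field energies converge along two-way matched sequences.** Let `X' ⊆ ℝ³` be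
`δ`-separated and `w₀` at distance `≥ ρ₀ > 0` from `X'`; let `S_j ⊆ ℝ³` be finite `δ`-separated
sets which are, for every radius `R` and every `ε > 0`, eventually two-way `ε`-matched with `X'`
on the ball `B_R(w₀)` (every point of `X'` in the ball has a point of `S_j` within `ε` and vice
versa), and let `w_j → w₀`.  Then `Σ_{q ∈ S_j} V_LJ(|w_j − q|) → Σ'_{q ∈ X'} V_LJ(|w₀ − q|)`.
Proof: the tail of the (absolutely summable) limit family beyond a finite set `Φ₀` is small;
choose `R` beyond `Φ₀` with the uniform far tail `(1/4)·250δ⁻⁵/(R − 1)` small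
(`sum_abs_lennardJones_le_of_far`); the `≤ (2R/δ + 1)³` points of `S_j` in the ball
(`card_le_of_separated_of_dist_le`) are injectively `ε`-matched to points of `X'` covering `Φ₀`,
and termwise the potential moves by less than a modulus of continuity of `V_LJ` on
`[ρ₀/2, R + 1]` (`exists_modulus_lennardJones`). [folklore] -/
theorem tendsto_sum_lennardJones_of_matched {X' : Set E3} {δ : ℝ} (hδ : 0 < δ)
    (hX' : ∀ p ∈ X', ∀ q ∈ X', p ≠ q → δ ≤ dist p q)
    {w₀ : E3} {ρ₀ : ℝ} (hρ₀ : 0 < ρ₀) (hw₀ : ∀ q ∈ X', ρ₀ ≤ dist w₀ q)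
    {S : ℕ → Finset E3} (hS : ∀ j, ∀ p ∈ S j, ∀ q ∈ S j, p ≠ q → δ ≤ dist p q)
    {w : ℕ → E3} (hw : Tendsto w atTop (𝓝 w₀))
    (hmatch : ∀ R ε : ℝ, 0 < ε → ∀ᶠ j in atTop,
      (∀ p ∈ X', dist p w₀ ≤ R → ∃ q ∈ S j, dist q p ≤ ε) ∧
        (∀ q ∈ S j, dist q w₀ ≤ R → ∃ p ∈ X', dist q p ≤ ε)) :
    Tendsto (fun j => ∑ q ∈ S j, lennardJones (dist (w j) q)) atTop
      (𝓝 (∑' q : X', lennardJones (dist w₀ q))) := by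
  classical
  set g : X' → ℝ := fun q => lennardJones (dist w₀ q) with hg
  have hUD : UniformlyDiscrete X' := ⟨δ, hδ, hX'⟩
  have hsum : Summable g := hUD.summable_lennardJones_dist w₀
  have hsabs : Summable fun q => |g q| := hsum.abs
  rw [Metric.tendsto_atTop]
  intro κ hκ
  -- (1) the tail of the limit family beyond a finite set `Φ₀`
  obtain ⟨Φ₀, hΦ₀⟩ : ∃ Φ₀ : Finset X', ∀ s : Finset X', Φ₀ ⊆ s →
      ∑' q : {q : X' // q ∉ s}, |g q| < κ / 4 := by
    have ht := tendsto_tsum_compl_atTop_zero fun q : X' => |g q|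
    rw [Metric.tendsto_atTop] at ht
    obtain ⟨Φ₀, h⟩ := ht (κ / 4) (by positivity)
    refine ⟨Φ₀, fun s hs => ?_⟩
    have h1 := h s hs
    rw [Real.dist_0_eq_abs, abs_of_nonneg (tsum_nonneg fun q => abs_nonneg _)] at h1
    exact h1
  -- (2) the radius `R`: beyond `Φ₀`, and with a small uniform far tail
  set C : ℝ := 1 / 4 * (250 * δ⁻¹ ^ 5) with hC
  have hC0 : 0 ≤ C := by positivity
  set R₀ : ℝ := ∑ q ∈ Φ₀, dist ((q : X') : E3) w₀ with hR₀
  have hR₀q : ∀ q ∈ Φ₀, dist ((q : X') : E3) w₀ ≤ R₀ := fun q hq =>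
    Finset.single_le_sum (f := fun q : X' => dist ((q : X') : E3) w₀)
      (fun _ _ => dist_nonneg) hq
  have hR₀0 : 0 ≤ R₀ := Finset.sum_nonneg fun _ _ => dist_nonneg
  have hCκ : 0 ≤ 4 * C / κ := by positivity
  set R : ℝ := R₀ + δ + 2 + 4 * C / κ with hR
  have hR0 : 0 ≤ R := by positivity
  set T : ℝ := R - 1 with hT
  have hT1 : 1 ≤ T := by rw [hT, hR]; linarith
  have hδT : δ ≤ T := by rw [hT, hR]; linarith
  have hT0 : 0 < T := one_pos.trans_le hT1
  have htail : 1 / 4 * (250 * δ⁻¹ ^ 5 * T⁻¹) ≤ κ / 4 := by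
    have h1 : 4 * C / κ ≤ T := by rw [hT, hR]; linarith
    rw [div_le_iff₀ hκ] at h1
    have h2 : 1 / 4 * (250 * δ⁻¹ ^ 5 * T⁻¹) = C / T := by
      rw [hC, div_eq_mul_inv]
      ring
    rw [h2, div_le_iff₀ hT0]
    linarith
  -- (3) the number of points of `S j` in the ball is at most `M`
  set M : ℝ := (2 * R / δ + 1) ^ 3 with hM
  have hM0 : 0 ≤ M := by positivity
  -- (4) a modulus of continuity of `V_LJ` on `[ρ₀/2, R + 1]` at level `κ/(4(M+1))`
  obtain ⟨η, hη, hmod⟩ := exists_modulus_lennardJones (a := ρ₀ / 2) (b := R + 1)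
    (κ := κ / (4 * (M + 1))) (by positivity) (by positivity)
  -- (5) the tolerance and the threshold
  set ε₀ : ℝ := min (η / 3) (min (δ / 4) (min (ρ₀ / 4) (1 / 2))) with hε₀
  have hε₀0 : 0 < ε₀ := lt_min (by positivity) (lt_min (by positivity)
    (lt_min (by positivity) (by norm_num)))
  have hε₀η : 3 * ε₀ ≤ η := by
    have := min_le_left (η / 3) (min (δ / 4) (min (ρ₀ / 4) (1 / 2))); linarith
  have hε₀δ : 4 * ε₀ ≤ δ := by
    have := (min_le_right (η / 3) _).trans (min_le_left (δ / 4) (min (ρ₀ / 4) (1 / 2)))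
    linarith
  have hε₀ρ : 4 * ε₀ ≤ ρ₀ := by
    have := ((min_le_right (η / 3) _).trans (min_le_right (δ / 4) _)).trans
      (min_le_left (ρ₀ / 4) (1 / 2))
    linarith
  have hε₀1 : 2 * ε₀ ≤ 1 := by
    have := ((min_le_right (η / 3) _).trans (min_le_right (δ / 4) _)).trans
      (min_le_right (ρ₀ / 4) (1 / 2))
    linarith
  obtain ⟨J, hJ⟩ := Filter.eventually_atTop.1
    (((Metric.tendsto_nhds.1 hw) ε₀ hε₀0).and (hmatch R ε₀ hε₀0))
  refine ⟨J, fun j hj => ?_⟩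
  obtain ⟨hwj, hm1, hm2⟩ := hJ j hj
  rw [Real.dist_eq]
  -- split `S j` into the points in the ball `B_R(w₀)` and the far ones
  set Sn := (S j).filter (fun q => dist q w₀ ≤ R) with hSn
  set Sf := (S j).filter (fun q => ¬ dist q w₀ ≤ R) with hSf
  have hsplit : ∑ q ∈ S j, lennardJones (dist (w j) q) =
      ∑ q ∈ Sn, lennardJones (dist (w j) q) + ∑ q ∈ Sf, lennardJones (dist (w j) q) :=
    (Finset.sum_filter_add_sum_filter_not _ _ _).symm
  -- (a) the far part is uniformly small
  have hfar : |∑ q ∈ Sf, lennardJones (dist (w j) q)| ≤ κ / 4 := by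
    refine (Finset.abs_sum_le_sum_abs _ _).trans ?_
    refine (sum_abs_lennardJones_le_of_far Sf (w j) hδ hδT hT1
      (fun p hp q hq hpq => hS j p (Finset.mem_filter.1 hp).1 q (Finset.mem_filter.1 hq).1 hpq)
      fun q hq => ?_).trans htail
    have hq : R < dist q w₀ := not_le.1 (Finset.mem_filter.1 hq).2
    have := dist_triangle q (w j) w₀
    rw [dist_comm q (w j)] at this
    rw [hT]
    linarith [hwj.le]
  -- (b) the matching of the near points with points of `X'`
  have hmf : ∀ q : E3, ∃ p : E3, (∃ p' ∈ X', dist q p' ≤ ε₀) → p ∈ X' ∧ dist q p ≤ ε₀ := by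
    intro q
    by_cases h : ∃ p' ∈ X', dist q p' ≤ ε₀
    · obtain ⟨p', hp', hqp'⟩ := h
      exact ⟨p', fun _ => ⟨hp', hqp'⟩⟩
    · exact ⟨q, fun h' => absurd h' h⟩
  choose m hm using hmf
  have hmSn : ∀ q ∈ Sn, m q ∈ X' ∧ dist q (m q) ≤ ε₀ := fun q hq =>
    hm q (hm2 q (Finset.mem_filter.1 hq).1 (Finset.mem_filter.1 hq).2)
  -- termwise the potential moves by less than the modulus
  have hterm : ∀ q ∈ Sn, |lennardJones (dist (w j) q) - lennardJones (dist w₀ (m q))| ≤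
      κ / (4 * (M + 1)) := by
    intro q hq
    obtain ⟨hmq, hdq⟩ := hmSn q hq
    have hqR : dist q w₀ ≤ R := (Finset.mem_filter.1 hq).2
    have h1 : ρ₀ ≤ dist w₀ (m q) := hw₀ _ hmq
    have h2 : dist w₀ (m q) ≤ R + 1 := by
      have := dist_triangle w₀ q (m q)
      rw [dist_comm w₀ q] at this
      linarith
    have h3 : dist w₀ (m q) ≤ dist (w j) q + 2 * ε₀ := by
      have ha := dist_triangle w₀ (w j) (m q)
      have hb := dist_triangle (w j) q (m q)
      rw [dist_comm w₀ (w j)] at ha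
      linarith [hwj.le]
    have h4 : dist (w j) q ≤ dist w₀ (m q) + 2 * ε₀ := by
      have ha := dist_triangle (w j) w₀ q
      have hb := dist_triangle w₀ (m q) q
      rw [dist_comm (m q) q] at hb
      linarith [hwj.le]
    refine (hmod _ _ (by linarith) ?_ (by linarith) h2 ?_).le
    · have := dist_triangle (w j) w₀ q
      rw [dist_comm w₀ q] at this
      linarith [hwj.le]
    · rw [abs_lt]
      constructor <;> linarith
  -- the number of near points
  have hcard : (Sn.card : ℝ) ≤ M := by
    have := card_le_of_separated_of_dist_le Sn w₀ hδ hR0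
      (fun c hc => (Finset.mem_filter.1 hc).2)
      (fun c hc d hd hcd => hS j c (Finset.mem_filter.1 hc).1 d (Finset.mem_filter.1 hd).1 hcd)
    rwa [finrank_euclideanSpace_fin] at this
  have hnear : |∑ q ∈ Sn, lennardJones (dist (w j) q) -
      ∑ q ∈ Sn, lennardJones (dist w₀ (m q))| ≤ κ / 4 := by
    rw [← Finset.sum_sub_distrib]
    refine (Finset.abs_sum_le_sum_abs _ _).trans ?_
    refine (Finset.sum_le_sum hterm).trans ?_
    rw [Finset.sum_const, nsmul_eq_mul]
    have h1 : (Sn.card : ℝ) * (κ / (4 * (M + 1))) ≤ M * (κ / (4 * (M + 1))) :=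
      mul_le_mul_of_nonneg_right hcard (by positivity)
    refine h1.trans ?_
    rw [mul_div_assoc', div_le_div_iff₀ (by positivity) (by positivity)]
    nlinarith
  -- (c) reindex the near sum by the matched points of `X'`
  have hinj : Set.InjOn m ↑Sn := by
    intro q hq q' hq' hqq'
    by_contra hne
    have h1 := hS j q (Finset.mem_filter.1 hq).1 q' (Finset.mem_filter.1 hq').1 hne
    obtain ⟨-, hdq⟩ := hmSn q hq
    obtain ⟨-, hdq'⟩ := hmSn q' hq'
    have := dist_triangle q (m q) q'
    rw [hqq', dist_comm (m q') q'] at this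
    rw [hqq'] at hdq
    linarith
  have hreidx : ∑ q ∈ Sn, lennardJones (dist w₀ (m q)) =
      ∑ p ∈ Sn.image m, lennardJones (dist w₀ p) :=
    (Finset.sum_image (f := fun p => lennardJones (dist w₀ p)) hinj).symm
  -- (d) ... as a finite set of `X'`
  set Mf : Finset X' := (Sn.image m).subtype (· ∈ X') with hMf
  have hMf_sum : ∑ q ∈ Mf, g q = ∑ p ∈ Sn.image m, lennardJones (dist w₀ p) := by
    rw [hMf, Finset.sum_subtype_of_mem (fun p => lennardJones (dist w₀ p)) fun p hp => ?_]
    obtain ⟨q, hq, rfl⟩ := Finset.mem_image.1 hp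
    exact (hmSn q hq).1
  -- (e) the matched points cover `Φ₀`
  have hΦMf : Φ₀ ⊆ Mf := by
    intro q hq
    rw [hMf, Finset.mem_subtype, Finset.mem_image]
    have hqR : dist ((q : X') : E3) w₀ ≤ R := (hR₀q q hq).trans (by rw [hR]; linarith)
    obtain ⟨s, hs, hsq⟩ := hm1 q q.2 hqR
    have hsn : s ∈ Sn := by
      rw [hSn, Finset.mem_filter]
      refine ⟨hs, ?_⟩
      have := dist_triangle s ((q : X') : E3) w₀
      have := hR₀q q hq
      rw [hR]
      linarith
    refine ⟨s, hsn, ?_⟩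
    obtain ⟨hms, hds⟩ := hmSn s hsn
    by_contra hne
    have h1 := hX' _ hms _ q.2 hne
    have := dist_triangle (m s) s q
    rw [dist_comm (m s) s] at this
    linarith
  -- (f) the tail of the limit family off the matched points
  have hcompl := hsum.sum_add_tsum_subtype_compl Mf
  have htailX : |∑' q : {q : X' // q ∉ Mf}, g q| ≤ κ / 4 := by
    have h1 := hΦ₀ Mf hΦMf
    have h2 : |∑' q : {q : X' // q ∉ Mf}, g q| ≤ ∑' q : {q : X' // q ∉ Mf}, |g q| := by
      have h3 : Summable fun q : {q : X' // q ∉ Mf} => ‖g q‖ := by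
        have := hsabs.subtype (fun q : X' => q ∉ Mf)
        simpa only [Real.norm_eq_abs, Function.comp_def] using this
      have := norm_tsum_le_tsum_norm h3
      simpa only [Real.norm_eq_abs] using this
    linarith
  -- assemble
  have e1 : ∑ q ∈ S j, lennardJones (dist (w j) q) - ∑' q : X', g q =
      ∑ q ∈ Sf, lennardJones (dist (w j) q) +
        (∑ q ∈ Sn, lennardJones (dist (w j) q) - ∑ q ∈ Sn, lennardJones (dist w₀ (m q))) -
        ∑' q : {q : X' // q ∉ Mf}, g q := by
    rw [hsplit, ← hcompl, hMf_sum, ← hreidx]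
    ring
  rw [e1]
  have ha := abs_sub (∑ q ∈ Sf, lennardJones (dist (w j) q) +
    (∑ q ∈ Sn, lennardJones (dist (w j) q) - ∑ q ∈ Sn, lennardJones (dist w₀ (m q))))
    (∑' q : {q : X' // q ∉ Mf}, g q)
  have hb := abs_add_le (∑ q ∈ Sf, lennardJones (dist (w j) q))
    (∑ q ∈ Sn, lennardJones (dist (w j) q) - ∑ q ∈ Sn, lennardJones (dist w₀ (m q)))
  linarith

end Summit.AtomisticToContinuum.Crystallization.Theorems.LocalLimitStable

end
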